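import Literature.NumberTheory.Automorphic.UnitaryLatticeTreeFrameChange   -- ★ p845958: `charpoly_coe_conj` (`χ_{TgT⁻¹} = χ_g`); brings ★ T1a `IsIntMatrix` (the A-69 congruence token), `Valued K ℤᵐ⁰`
import Mathlib.LinearAlgebra.Matrix.Charpoly.Basic
import Mathlib.RingTheory.Ideal.Quotient.Basic
import HarnessLib

/-!
# Characteristic polynomials of congruent integral matrices are congruent: `A ≡ B mod c ⇒ χ_A ≡ χ_B mod c`, and `χ_{kAk⁻¹} = χ_A` (Lang, *Algebra*, XIV §3)

Topic `NumberTheory/Automorphic`; namespace `Literature.NumberTheory.Automorphic.UnitaryLatticeTree` (next to ★ T1a's `IsIntMatrix`).  THEOREMS ONLY (no definition, no instance,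
no notation, no named fact, no `sorry`).  Road «S3-tree» of cell `pub/hodgecm-mathlib` (crux H413 = `stmt-HodgeConjecture-24833`), organ A-70 «residually-unipotent classes of
`U₃(𝒪∕𝔭²)`» (F0P3-p03 (g13)): head §0→ `charpoly_congr_sq_of_levelTwo_conj` of the statement-first file (reader ref5 R-55 «=», «harmless to land»), here in the GENERIC level-`c`
form the T4′-GEN congruence token uses (★ `UnitaryLatticeTreeLevelShiftClass`, A-69 (β)): for square matrices over a valued field `K`, if `B` is integral and `c⁻¹·(A − B)` is integral
(`A ≡ B mod c`), then every coefficient of `χ_A − χ_B` is divisible by `c` in `𝒪 = 𝒪[K]`; combined with `χ_{kAk⁻¹} = χ_A` this says that the characteristic polynomial MOD `c` is an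
invariant of the level-`c` conjugacy class — the easy half of «regular ⇒ char poly decides» (memo A-70 §1).  HONEST LABEL: HC_CM is proved only modulo the printed citations (2 remaining
named inputs hLiu418, h413) until rung 0 closes; elementary linear algebra only.

THE PRINT. [Lang2002, Ch. XIV §3 (pp. 561–563)]: the characteristic polynomial `P_A(t) = det(tI − A)` has coefficients that are polynomial functions of the entries of `A` with integer
coefficients, and `P_{BAB⁻¹} = P_A`.  Hence (i) it commutes with ring homomorphisms (Mathlib `Matrix.charpoly_map`) — applied to the reduction `𝒪 → 𝒪∕(c)` this gives the congruence;
(ii) it is a class invariant (Mathlib `Matrix.charpoly_units_conj`).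

* §1 `exists_map_subtype_eq_of_isIntMatrix` (an integral matrix comes from `M_N(𝒪)`), `v_charpoly_coeff_le_one` (its char poly has integral coefficients).
* §2 **`v_inv_mul_charpoly_coeff_sub_le_one`** — `IsIntMatrix B → v c ≤ 1 → IsIntMatrix (c⁻¹ • (A − B)) → ∀ i, v (c⁻¹ · (coeff_i χ_A − coeff_i χ_B)) ≤ 1`.
* §3 (over ★ `charpoly_coe_conj`, p845958) **`v_inv_mul_charpoly_coeff_sub_le_one_of_conj`** — the level-`c` class invariance: `IsIntMatrix B → v c ≤ 1 →
  IsIntMatrix (c⁻¹ • (↑(k * A * k⁻¹) − ↑B)) → ∀ i, v (c⁻¹ · (coeff_i χ_A − coeff_i χ_B)) ≤ 1` (= §0→ of the A-70 heads at `c = ϖ²`, with the unused binders dropped per ref5 R-55).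

## References
* [Lang2002] S. Lang, *Algebra*, rev. 3rd ed., GTM 211 (2002): Ch. XIV §3 «The characteristic polynomial», pp. 561–563.
* [Kottwitz1986] R. E. Kottwitz, *Stable trace formula: elliptic singular terms*, Math. Ann. 275 (1986): §3 (congruence classes of compact elements; context of the T4′-GEN token).
-/

set_option autoImplicit false

noncomputable section

open Matrix Polynomial
open scoped Valued WithZero

namespace Literature.NumberTheory.Automorphic.UnitaryLatticeTree

variable {K : Type*} [Field K] [Valued K ℤᵐ⁰] {N : ℕ}

/-! ## §1 Integral matrices come from `M_N(𝒪)`; their characteristic polynomials are integral -/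

/-- An integral matrix is the image of a matrix over `𝒪 = 𝒪[K]`. [cite: Lang2002, Ch. XIV §3 p. 561] -/
theorem exists_map_subtype_eq_of_isIntMatrix {M : Matrix (Fin N) (Fin N) K} (hM : IsIntMatrix M) :
    ∃ M₀ : Matrix (Fin N) (Fin N) 𝒪[K], M₀.map (algebraMap 𝒪[K] K) = M :=
  ⟨fun i j => ⟨M i j, hM i j⟩, by ext i j; rfl⟩

/-- The characteristic polynomial of an integral matrix has integral coefficients. [cite: Lang2002, Ch. XIV §3 p. 561] -/
theorem v_charpoly_coeff_le_one {M : Matrix (Fin N) (Fin N) K} (hM : IsIntMatrix M) (i : ℕ) : Valued.v (M.charpoly.coeff i) ≤ 1 := by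
  obtain ⟨M₀, rfl⟩ := exists_map_subtype_eq_of_isIntMatrix hM
  rw [Matrix.charpoly_map, Polynomial.coeff_map]
  exact (M₀.charpoly.coeff i).2

/-! ## §2 Congruent integral matrices have congruent characteristic polynomials -/

/-- **`A ≡ B mod c ⇒ χ_A ≡ χ_B mod c`**: if `B` is integral, `v c ≤ 1` and `c⁻¹·(A − B)` is integral, then `v (c⁻¹ · (coeff_i χ_A − coeff_i χ_B)) ≤ 1` for every `i`
(reduction modulo the ideal `(c)` of `𝒪` commutes with `charpoly`). [cite: Lang2002, Ch. XIV §3 p. 561] -/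
theorem v_inv_mul_charpoly_coeff_sub_le_one {A B : Matrix (Fin N) (Fin N) K} (hB : IsIntMatrix B) {c : K} (hc : Valued.v c ≤ 1)
    (hAB : IsIntMatrix (c⁻¹ • (A - B))) (i : ℕ) :
    Valued.v (c⁻¹ * (A.charpoly.coeff i - B.charpoly.coeff i)) ≤ 1 := by
  by_cases hc0 : c = 0
  · rw [hc0, _root_.inv_zero, zero_mul, map_zero]; exact zero_le_one
  -- lift `B`, `E := c⁻¹ (A − B)` and `c` to `𝒪`
  obtain ⟨B₀, hB₀⟩ := exists_map_subtype_eq_of_isIntMatrix hB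
  obtain ⟨E₀, hE₀⟩ := exists_map_subtype_eq_of_isIntMatrix hAB
  let c₀ : 𝒪[K] := ⟨c, hc⟩
  have hA : A = (B₀ + c₀ • E₀).map (algebraMap 𝒪[K] K) := by
    have hE : c⁻¹ • (A - B) = E₀.map (algebraMap 𝒪[K] K) := hE₀.symm
    have : A = B + c • (c⁻¹ • (A - B)) := by rw [smul_smul, mul_inv_cancel₀ hc0, one_smul, add_sub_cancel]
    rw [this, hE, ← hB₀]
    ext i j
    simp only [Matrix.map_apply, Matrix.add_apply, Matrix.smul_apply, smul_eq_mul, map_add, map_mul]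
    rfl
  -- reduce modulo the ideal `(c₀)`
  let I : Ideal 𝒪[K] := Ideal.span {c₀}
  have hred : (B₀ + c₀ • E₀).map (Ideal.Quotient.mk I) = B₀.map (Ideal.Quotient.mk I) := by
    ext i j
    simp only [Matrix.map_apply, Matrix.add_apply, Matrix.smul_apply, smul_eq_mul, map_add, map_mul]
    rw [Ideal.Quotient.eq_zero_iff_mem.2 (Ideal.mem_span_singleton_self c₀), zero_mul, add_zero]
  have hcoeff : Ideal.Quotient.mk I ((B₀ + c₀ • E₀).charpoly.coeff i) = Ideal.Quotient.mk I (B₀.charpoly.coeff i) := by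
    rw [← Polynomial.coeff_map, ← Polynomial.coeff_map, ← Matrix.charpoly_map, ← Matrix.charpoly_map, hred]
  rw [Ideal.Quotient.eq, Ideal.mem_span_singleton'] at hcoeff
  obtain ⟨d, hd⟩ := hcoeff
  -- push to `K`
  have hdiff : A.charpoly.coeff i - B.charpoly.coeff i = (algebraMap 𝒪[K] K d) * c := by
    rw [hA, ← hB₀, Matrix.charpoly_map, Matrix.charpoly_map, Polynomial.coeff_map, Polynomial.coeff_map, ← map_sub, ← hd, map_mul]
    rfl
  rw [hdiff, ← mul_assoc, mul_comm c⁻¹, mul_assoc, inv_mul_cancel₀ hc0, mul_one]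
  exact d.2

/-! ## §3 Conjugation invariance and the level-`c` class invariance -/

/-- **The characteristic polynomial mod `c` is a level-`c` class invariant**: if `k A k⁻¹ ≡ B mod c` (the A-69 token `IsIntMatrix (c⁻¹ • (↑(k * A * k⁻¹) − ↑B))`) with `B` integral,
then `χ_A ≡ χ_B mod c` coefficientwise (= head §0→ of the A-70 statement-first file at `c = ϖ²`; the binders `hA hk hk′` there are unnecessary, as ref5 R-55 noted).
[cite: Lang2002, Ch. XIV §3 pp. 561–562] [cite: Kottwitz1986, §3] -/
theorem v_inv_mul_charpoly_coeff_sub_le_one_of_conj {A B k : GL (Fin N) K} (hB : IsIntMatrix (B : Matrix (Fin N) (Fin N) K)) {c : K} (hc : Valued.v c ≤ 1)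
    (hconj : IsIntMatrix (c⁻¹ • (((k * A * k⁻¹ : GL (Fin N) K) : Matrix (Fin N) (Fin N) K) - (B : Matrix (Fin N) (Fin N) K)))) (i : ℕ) :
    Valued.v (c⁻¹ * ((A : Matrix (Fin N) (Fin N) K).charpoly.coeff i - (B : Matrix (Fin N) (Fin N) K).charpoly.coeff i)) ≤ 1 := by
  rw [← charpoly_coe_conj k A]
  exact v_inv_mul_charpoly_coeff_sub_le_one hB hc hconj i

end Literature.NumberTheory.Automorphic.UnitaryLatticeTree
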